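import Summits.CriticalPhenomena.PercolationContinuityZ3.Theorems.PercNearOneGluingNoHeavyLowerTailSahiSlotPairConeThresholdCylinder

/-!
# Threshold-cylinder TOWERS: an all-dimension recursive family of pinned-good up-sets with non-empty bottom slices

Support file of the one-cut programme (crux `NoHeavyLowerTail`, stmt-CriticalPhenomena-4575; cell `prim-masterthm`, seat P3, gen 24;
`run/shared/lean/prim/prim-masterthm/prim-masterthm-p3/HIERARCHY.md` §32(b'')).

The lifts `thrCylTop E = Θ × [3] ∪ E × {2}` and `thrCylTwo E = Θ × [3] ∪ E × {1,2}` of `…PairConeThresholdCylinder` take a set `E ⊇ Θ = {x_last ≥ 1}`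
with a pinned certificate and return a pinned-good set one dimension up which CONTAINS the threshold `{x : x_n ≥ 1}` of the OLD last axis.  After
swapping the last two axes (pinned certificates transport along axis permutations, `PinnedGood.perm`) the output is therefore again an admissible
input.  Iterating gives, for every seed `E ⊇ Θ` and every word `ls : List Bool` (`true ↦ cylTop`, `false ↦ cylTwo`), the pinned-good set
`cylTower E ls ⊆ [3]^{n + |ls| + 1}` — e.g. from the seed `Θ ⊆ [3]^{n+1}` itself (`pinnedGood_cylTower_thr`), in every dimension.
* `swapLast`, `swapLastSet`, `mem_swapSet`, `PinnedGood.swapLastSet`;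
* `thr_subset_swap_thrCylTop`, `thr_subset_swap_thrCylTwo` (the swapped lifts contain the new last-axis threshold);
* `cylTower`, **`pinnedGood_cylTower`**, `pinnedGood_cylTower_thr`.
HONEST LABEL: instances/iteration of certificate-format theorems; no open cell changes status.  Pure, standard axioms. [this work]
-/

noncomputable section

namespace Summit.CriticalPhenomena.PercolationContinuityZ3.Theorems

open Finset Function
open Literature.Combinatorics.Sahi2008

namespace SahiSlot

open SahiGridPattern SahiGrid3

variable {n : ℕ}

/-- The transposition of the last two axes of `[3]^{n+2}`. [this work] -/
def swapLast (n : ℕ) : Equiv.Perm (Fin (n + 2)) := Equiv.swap (Fin.last (n + 1)) (Fin.castSucc (Fin.last n))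

/-- The image of `X ⊆ [3]^{n+2}` under the swap of the last two axes (as a preimage: `x ∈ swapLastSet X ↔ x ∘ swapLast ∈ X`). [this work] -/
def swapLastSet (X : Finset (Pd (n + 2))) : Finset (Pd (n + 2)) := univ.filter fun x => (x ∘ ⇑(swapLast n)) ∈ X

/-- Membership in the swapped set. [this work] -/
theorem mem_swapSet (X : Finset (Pd (n + 2))) (x : Pd (n + 2)) : x ∈ swapLastSet X ↔ (x ∘ ⇑(swapLast n)) ∈ X := by
  simp [swapLastSet]

/-- Pinned certificates survive the swap of the last two axes. [this work] -/
theorem PinnedGood.swapLastSet {X : Finset (Pd (n + 2))} (h : PinnedGood (n + 2) X) : PinnedGood (n + 2) (swapLastSet X) :=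
  h.perm (swapLast n) (fun p => mem_swapSet X p)

/-- The value of `x ∘ swapLast` at the old last axis is the value of `x` at the new last axis. [this work] -/
theorem comp_swapLast_castSucc_last (x : Pd (n + 2)) : (x ∘ ⇑(swapLast n)) (Fin.castSucc (Fin.last n)) = x (Fin.last (n + 1)) := by
  simp [swapLast, Equiv.swap_apply_right]

/-- A point of `[3]^{n+2}` whose old-last coordinate (after the swap) is non-zero lies in the cylinder `Θ × [3]`. [this work] -/
theorem comp_swapLast_mem_liftAll_thr {x : Pd (n + 2)} (hx : x (Fin.last (n + 1)) ≠ 0) : (x ∘ ⇑(swapLast n)) ∈ liftAll (Thr n) := by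
  simp only [liftAll, Thr, liftTwo, Finset.mem_filter, Finset.mem_univ, true_and]
  have : Fin.init (x ∘ ⇑(swapLast n)) (Fin.last n) = x (Fin.last (n + 1)) := by
    rw [Fin.init, comp_swapLast_castSucc_last]
  rw [this]; exact hx

/-- Members of the threshold `Θ ⊆ [3]^{n+2}` have non-zero last coordinate. [this work] -/
theorem last_ne_zero_of_mem_thr {x : Pd (n + 2)} (hx : x ∈ Thr (n + 1)) : x (Fin.last (n + 1)) ≠ 0 := by
  have h := hx
  simp only [Thr, liftTwo, Finset.mem_filter, Finset.mem_univ, true_and] at h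
  exact h

/-- The swapped threshold-cylinder-top lift contains the new last-axis threshold. [this work] -/
theorem thr_subset_swap_thrCylTop (E : Finset (Pd (n + 1))) : Thr (n + 1) ⊆ swapLastSet (thrCylTop E) := by
  intro x hx
  rw [mem_swapSet, thrCylTop, Finset.mem_union]
  exact Or.inl (comp_swapLast_mem_liftAll_thr (last_ne_zero_of_mem_thr hx))

/-- The swapped threshold-cylinder-two lift contains the new last-axis threshold. [this work] -/
theorem thr_subset_swap_thrCylTwo (E : Finset (Pd (n + 1))) : Thr (n + 1) ⊆ swapLastSet (thrCylTwo E) := by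
  intro x hx
  rw [mem_swapSet, thrCylTwo, Finset.mem_union]
  exact Or.inl (comp_swapLast_mem_liftAll_thr (last_ne_zero_of_mem_thr hx))

/-- **Threshold-cylinder tower** over a seed `E ⊆ [3]^{n+1}`: apply `thrCylTop` (`true`) or `thrCylTwo` (`false`) and swap the last two axes,
once per letter of `ls` (outermost letter last). [this work] -/
def cylTower (E : Finset (Pd (n + 1))) : (ls : List Bool) → Finset (Pd (n + ls.length + 1))
  | [] => E
  | true :: ls => swapLastSet (thrCylTop (cylTower E ls))
  | false :: ls => swapLastSet (thrCylTwo (cylTower E ls))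

/-- **Every tower over a pinned-good seed `E ⊇ Θ` contains the threshold and is pinned-good**, in every dimension. [this work] -/
theorem pinnedGood_cylTower {E : Finset (Pd (n + 1))} (hTE : Thr n ⊆ E) (h : PinnedGood (n + 1) E) :
    ∀ ls : List Bool, Thr (n + ls.length) ⊆ cylTower E ls ∧ PinnedGood (n + ls.length + 1) (cylTower E ls)
  | [] => ⟨hTE, h⟩
  | true :: ls => by
    obtain ⟨h1, h2⟩ := pinnedGood_cylTower hTE h ls
    exact ⟨thr_subset_swap_thrCylTop _, (h2.thrCylTop h1).swapLastSet⟩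
  | false :: ls => by
    obtain ⟨h1, h2⟩ := pinnedGood_cylTower hTE h ls
    exact ⟨thr_subset_swap_thrCylTwo _, (h2.thrCylTwo h1).swapLastSet⟩

/-- Towers over the threshold `Θ ⊆ [3]^{n+1}` itself are pinned-good: an explicit infinite family, in every dimension, of pinned-good up-sets all of
whose axis-slices along the construction axes are non-empty. [this work] -/
theorem pinnedGood_cylTower_thr (n : ℕ) (ls : List Bool) : PinnedGood (n + ls.length + 1) (cylTower (Thr n) ls) :=
  (pinnedGood_cylTower (Finset.Subset.refl _) (pinnedGood_threshold_one n) ls).2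

/-- VALUE-LEVEL corollary for towers over `Θ`. [this work] -/
theorem sStarD_cylTower_thr_nonneg (n : ℕ) (ls : List Bool) (B C : Finset (Pd (n + ls.length + 1)))
    (hB : IsUpperSet (B : Set (Pd (n + ls.length + 1)))) (hC : IsUpperSet (C : Set (Pd (n + ls.length + 1)))) :
    0 ≤ sStarD (cylTower (Thr n) ls) B C :=
  (pinnedGood_cylTower_thr n ls).sStarD_nonneg B C hB hC

end SahiSlot

end Summit.CriticalPhenomena.PercolationContinuityZ3.Theorems
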